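import Summits.BirchSwinnertonDyer.BirchSwinnertonDyer.Theorems.GenusKolyvaginAtTwoShaCardDvdPowAtTwoRTSharpExponentRat
import Summits.BirchSwinnertonDyer.BirchSwinnertonDyer.Theorems.GenusKolyvaginAtTwoShaCardDvdPowAtTwoRTShaFiniteAtTwoRat
import HarnessLib

/-!
# Route `GenusKolyvaginAtTwo`, U_T `ShaCardDvdPowAtTwoRT` (stmt-BirchSwinnertonDyer-23469, rev 39; lineage 23658) — PER-CELL B2Q SCHEMA: `#Ш(E/ℚ)[2^∞] = 16`

Text by the route pen `bsd-idea-1` g21 (`pub/ideators/bsd-idea-1/b2q/PerCellB2Q.lean`, sha16 20c985960c87124f), landed by seat `bsd-line-gk2-p4` g23 on the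
pen's ask (helper, `--supports stmt-BirchSwinnertonDyer-23469 --as helper`). THEOREM-ONLY file, no `sorry`, no new definition.

On U_T's rational habitat frame (gk2-p4's **B2Q** `two_pow_M0_smul_eq_zero_of_mem_sha_rat_onHabitat`, p748779: `Ш(E/ℚ)[2^∞]` is killed by
`2^{M₀}`, modulo Q2 `KolyvaginRelationAtTwo`, with `w(E) = +1`), take `M₀ = 2` and add the two UNCONDITIONAL 2-descent data of a cell as
hypotheses — `#Ш(E/ℚ)[2] = 4` (2-Selmer rank `C − T − R = 2`) and `Ш(E/ℚ)[2] ⊆ 2·Ш(E/ℚ)[4]` (PARI `ellrank`'s Cassels-pairing datum `s = 0`) —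
then `Ш(E/ℚ)[2^∞] ≅ (ℤ/4)²`, in particular **`#Ш(E/ℚ)[2^∞] = 16`**.  This is the kernel form of the per-cell instrument of the pen memo
`pub/ideators/bsd-idea-1/b2q/PERCELL-B2Q-g21.md`: on an X5 NegDisc habitat cell with `v₂(Ш_an) = 4`, a Gross–Zagier index certificate
`ord₂ [E(K) : ℤ y_K] = 2` (⟹ `hndiv` at `2^3`, since `E(K[1])[2] = 0`) plus `ellrank(E) = [0,2,0,·]` give the 2-part of BSD for `E/ℚ` on that cell,
conditionally on Q2 (= print fact `prop37_2`) and the instantiated Heegner datum.  §1 is pure group theory (first isomorphism theorem for doubling).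
BSD is NOT proved by this; U_T is NOT proved by this; nothing is closed.
-/

set_option autoImplicit false
set_option linter.dupNamespace false

noncomputable section

open scoped Classical

namespace Summit.BirchSwinnertonDyer.BirchSwinnertonDyer.Theorems.GenusExact.PerCellB2Q

open WeierstrassCurve NumberField IsDedekindDomain Literature.NumberTheory.EllipticCurves
  Literature.NumberTheory.EllipticCurves.ModularForms AddSubgroup Literature.NumberTheory.EllipticCurves.RingClassField
open Summit.BirchSwinnertonDyer.BirchSwinnertonDyer.Theses.GenusKolyvaginAtTwo (KolyvaginRelationAtTwo)
open Summit.BirchSwinnertonDyer.BirchSwinnertonDyer.Theorems.GenusExact.PlusDescent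

/-! ## §1  Group theory: exponent `4`, `#H[2] = 4`, `H[2] ⊆ 2H` ⟹ `#H = 16` -/

/-- If `4 • x = 0` on `H`, `H[2] ⊆ 2 • H` and `#H[2] = 4`, then `#H = 16` (doubling `H → H` has kernel `H[2]` and image `H[2]`; no finiteness
hypothesis is needed: `Nat.card` is multiplicative along `H/ker ≅ range`). [folklore] -/
theorem natCard_eq_sixteen_of_exponent_four {G : Type*} [AddCommGroup G] (H : AddSubgroup G)
    (h4 : ∀ x ∈ H, (4 : ℤ) • x = 0)
    (hdiv : ∀ x ∈ H, (2 : ℤ) • x = 0 → ∃ y ∈ H, (2 : ℤ) • y = x)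
    (h2 : Nat.card {x : G // x ∈ H ∧ (2 : ℤ) • x = 0} = 4) :
    Nat.card H = 16 := by
  classical
  let φ : H →+ H :=
    { toFun := fun x => ⟨(2 : ℤ) • (x : G), H.zsmul_mem x.2 2⟩
      map_zero' := by ext; simp
      map_add' := by intro x y; ext; simp [smul_add] }
  have hker : Nat.card φ.ker = 4 := by
    rw [← h2]
    refine Nat.card_congr ?_
    refine
      { toFun := fun x => ⟨(x.1 : G), ⟨x.1.2, by
            have hx := x.2
            rw [AddMonoidHom.mem_ker] at hx
            exact congrArg Subtype.val hx⟩⟩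
        invFun := fun x => ⟨⟨x.1, x.2.1⟩, by
            rw [AddMonoidHom.mem_ker]; ext; exact x.2.2⟩
        left_inv := fun x => by ext; rfl
        right_inv := fun x => by rfl }
  have hrange : Nat.card φ.range = 4 := by
    rw [← h2]
    refine Nat.card_congr ?_
    refine
      { toFun := fun x => ⟨(x.1 : G), ⟨x.1.2, by
            obtain ⟨y, hy⟩ := x.2
            have : ((2 : ℤ) • (y : G)) = (x.1 : G) := congrArg Subtype.val hy
            rw [← this, smul_smul]; norm_num; exact h4 _ y.2⟩⟩
        invFun := fun x => ⟨⟨x.1, x.2.1⟩, by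
            obtain ⟨y, hyH, hy⟩ := hdiv x.1 x.2.1 x.2.2
            exact ⟨⟨y, hyH⟩, by ext; exact hy⟩⟩
        left_inv := fun x => by ext; rfl
        right_inv := fun x => by rfl }
  have hmul : Nat.card H = Nat.card φ.ker * Nat.card φ.range := by
    rw [← Nat.card_congr (QuotientAddGroup.quotientKerEquivRange φ).toEquiv, mul_comm]
    exact φ.ker.card_eq_card_quotient_mul_card_addSubgroup
  rw [hmul, hker, hrange]

/-! ## §2  The per-cell schema on U_T's rational frame -/

/-- **PER-CELL B2Q SCHEMA.** On U_T's rational habitat frame with `w(E) = +1` and the Gross–Zagier divisibility bound at `M₀ = 2`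
(`y_K ∉ 2^3 · E(K[1])`), the two 2-descent data of the cell — `#Ш(E/ℚ)[2] = 4` and `Ш(E/ℚ)[2] ⊆ 2·Ш(E/ℚ)[4]` (Cassels pairing on
`Sel₂` trivial, PARI `ellrank` datum `s = 0`) — force **`#Ш(E/ℚ)[2^∞] = 16`** (modulo Q2).  Ingredients by name: B2Q
`two_pow_M0_smul_eq_zero_of_mem_sha_rat_onHabitat` (exponent `∣ 4`), `finite_primaryComponent_sha_rat_two_onHabitat` (finiteness), §1.
[cite: Kolyvagin1989Izv, Thm. B₂] [cite: GrossLMS1991, Prop. 3.7(2)] [cite: Cassels1962ArithmeticIV, Thm. 1.1] -/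
theorem natCard_primaryComponent_sha_rat_two_eq_sixteen_onHabitat (hQ2 : KolyvaginRelationAtTwo)
    (W : WeierstrassCurve ℚ) [W.IsElliptic] [W.IsGloballyMinimal] [NeZero (W.conductorNorm ℤ)] (hcm : ¬ W.HasCM)
    (hT : Odd W.tamagawaProduct) (v : HeightOneSpectrum (𝓞 ℚ)) (h2v : ((2 : ℕ) : 𝓞 ℚ) ∉ v.asIdeal)
    (hNv : ((W.conductorNorm ℤ : ℕ) : 𝓞 ℚ) ∈ v.asIdeal) (hmult : W.HasMultiplicativeReductionAt v) (hneg : W.Δ < 0)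
    (K : Type) [Field K] [NumberField K] (hIQ : IsImaginaryQuadratic K) (hodd : Odd (NumberField.discr K))
    (h3 : NumberField.discr K ≠ -3) (hHe : SatisfiesHeegnerHypothesis (W.conductorNorm ℤ) K)
    (hsq1 : ¬ IsSquare ((NumberField.discr K : ℚ) * -|W.Δ|)) (hsq2 : ¬ IsSquare ((NumberField.discr K : ℚ) * (-(2 * |W.Δ|))))
    (hρ : ∀ n : ℕ, 0 < n → W.HasSurjectiveModNGaloisRep ((2 : ℤ) ^ n))
    (Dt : ModularParametrizationData W (W.conductorNorm ℤ)) (β : ℤ) (ι : K →+* ℂ) (d₁ : KolyvaginHeegnerData Dt β ι 1)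
    (hndiv : ¬ ∃ Q : (W.baseChange (ringClassField K ι 1)).toAffine.Point, ((2 ^ (2 + 1) : ℕ) : ℤ) • Q = d₁.derivedPoint)
    (hw1 : W.rootNumber = 1)
    (h2 : Nat.card {a : W.galH1 // a ∈ W.sha ∧ (2 : ℤ) • a = 0} = 4)
    (hdiv : ∀ a ∈ W.sha, (2 : ℤ) • a = 0 → ∃ b ∈ W.sha, (4 : ℤ) • b = 0 ∧ (2 : ℤ) • b = a) :
    Nat.card (AddCommGroup.primaryComponent W.sha 2) = 16 := by
  haveI : Fact (Nat.Prime 2) := ⟨Nat.prime_two⟩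
  haveI := finite_primaryComponent_sha_rat_two_onHabitat hQ2 W hcm hT v h2v hNv hmult hneg K hIQ hodd h3 hHe hsq1 hsq2 hρ Dt β ι d₁ 2 hndiv
  set H : AddSubgroup W.sha := AddCommGroup.primaryComponent W.sha 2 with hH
  -- membership in `Ш[2^∞]` from a `2`-power annihilator
  have hmemH : ∀ (y : W.sha) (i : ℕ), (2 ^ i) • y = 0 → y ∈ H := by
    intro y i hy
    exact (AddCommGroup.mem_primaryComponent).2 ⟨i, hy⟩
  -- coercion bookkeeping `↥Ш → H¹`
  have hcoe : ∀ (y : W.sha) (n : ℤ), n • y = 0 ↔ n • (y : W.galH1) = 0 := by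
    intro y n
    constructor
    · intro h
      have := congrArg (fun z : W.sha => (z : W.galH1)) h
      simpa only [AddSubgroupClass.coe_zsmul, ZeroMemClass.coe_zero] using this
    · intro h
      apply Subtype.ext
      simpa only [AddSubgroupClass.coe_zsmul, ZeroMemClass.coe_zero] using h
  -- exponent `4` on `Ш[2^∞]` = B2Q at `M₀ = 2`
  have h4 : ∀ x ∈ H, (4 : ℤ) • x = 0 := by
    intro x hx
    obtain ⟨j, hj⟩ := (AddCommGroup.mem_primaryComponent).1 hx
    have hxj : ((2 ^ j : ℕ) : ℤ) • (x : W.galH1) = 0 := by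
      rw [← hcoe, natCast_zsmul]; exact hj
    have hB := two_pow_M0_smul_eq_zero_of_mem_sha_rat_onHabitat hQ2 W hcm hT v h2v hNv hmult hneg K hIQ hodd h3 hHe hsq1 hsq2 hρ Dt β ι d₁ 2
      hndiv hw1 j (x : W.galH1) x.2 hxj
    have h22 : ((2 ^ 2 : ℕ) : ℤ) = 4 := by norm_num
    rw [h22] at hB
    exact (hcoe x 4).mpr hB
  -- `Ш[2] ⊆ 2 · Ш[4]` inside `Ш[2^∞]`
  have hdivH : ∀ x ∈ H, (2 : ℤ) • x = 0 → ∃ y ∈ H, (2 : ℤ) • y = x := by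
    intro x hx h2x
    obtain ⟨b, hb, h4b, h2b⟩ := hdiv (x : W.galH1) x.2 ((hcoe x 2).mp h2x)
    have h4b' : (2 ^ 2) • (⟨b, hb⟩ : W.sha) = 0 := by
      rw [← natCast_zsmul, hcoe]; norm_num; exact h4b
    refine ⟨⟨b, hb⟩, hmemH ⟨b, hb⟩ 2 h4b', ?_⟩
    apply Subtype.ext
    simpa only [AddSubgroupClass.coe_zsmul] using h2b
  -- `#Ш[2^∞][2] = #Ш[2] = 4`
  have h2H : Nat.card {x : W.sha // x ∈ H ∧ (2 : ℤ) • x = 0} = 4 := by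
    rw [← h2]
    have h21 : ∀ (a : W.galH1) (ha : a ∈ W.sha), (2 : ℤ) • a = 0 → (2 ^ 1) • (⟨a, ha⟩ : W.sha) = 0 := by
      intro a ha h; rw [pow_one, ← natCast_zsmul, hcoe]; show ((2 : ℕ) : ℤ) • a = 0; exact_mod_cast h
    refine Nat.card_congr ?_
    refine
      { toFun := fun x => ⟨(x.1 : W.galH1), ⟨x.1.2, (hcoe x.1 2).mp x.2.2⟩⟩
        invFun := fun a => ⟨⟨a.1, a.2.1⟩, ⟨hmemH ⟨a.1, a.2.1⟩ 1 (h21 a.1 a.2.1 a.2.2), (hcoe ⟨a.1, a.2.1⟩ 2).mpr a.2.2⟩⟩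
        left_inv := fun x => by ext; rfl
        right_inv := fun a => by rfl }
  exact natCard_eq_sixteen_of_exponent_four H h4 hdivH h2H

end Summit.BirchSwinnertonDyer.BirchSwinnertonDyer.Theorems.GenusExact.PerCellB2Q

end
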